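import Literature.NumberTheory.GaloisRepresentations.SerreWeightLevelOneGeneralEvaluationProofs
import HarnessLib

/-!
# Serre's recipe at a level-one shape `(ψ₁^β ∗; 0 ψ₁^α)`, `1 ≤ α, β ≤ q − 2`, ADJACENT exponents included:
# the LOWER BOUND `1 + q·min(α, β) + max(α, β) ≤ k(ρ̄_F)` (no uniqueness hypothesis)

Topic `NumberTheory/GaloisRepresentations`.  A *proofs* file (theorems only: no definition, no named fact, no `sorry`, no instance,
no notation).  Sequel of `SerreWeightLevelOneGeneralEvaluationProofs`, which EVALUATES `k(ρ̄_F) = 1 + q·min(α, β) + max(α, β)` in the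
generic range `|α − β| ≠ 1`.  At an ADJACENT shape Serre's §2.4 (ii) distinguishes peu / très ramifiée, and — without the uniqueness of
the normalisation — a representation given with the shape `(β, α) = (α', α' + 1)` may a priori also carry the swapped normalisation
`(α' + 1, α')`, where the très ramifiée correction applies.  That correction only ADDS `q − 1` (Serre §2.4 (ii₂):
`k = 1 + qa + b + q − 1`), so the generic value survives as a LOWER BOUND at every shape with `1 ≤ α, β ≤ q − 2`:

* `le_serreWeightLocal_of_hasLevelOneInertiaShape` — `1 + q·min(α, β) + max(α, β) ≤ serreWeightLocal ρ ι`.  TAME: every tame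
  normalisation `(a', b')` has `{a', b'} = {α, β}` and the value is attained ((2.3.2)); WILD: every wild normalisation `(β', α')` has
  `{β', α'} = {β, α}` (`β' = q − 1` is excluded since neither `ψ₁^β` nor `ψ₁^α` is trivial), and §2.4 gives `1 + q·min + max` in
  cases (i)/(ii₁) and `1 + q·min + max + (q − 1)` in case (ii₂) (`q ≠ 2` because `q ≥ α + 2 ≥ 3`); no level-two weight occurs
  (`not_isLevelTwoWeight_of_hasLevelOneInertiaShape`);
* `le_serreWeight_of_hasLevelOneInertiaShape` — the global wrapper at a local restriction datum (`q = p`).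

This is all a weight-EXCLUSION argument needs (`k(ρ̄) ≥ q + 2 > w`).  Consumer: route BSD/TeichmullerTwistDescent, the Kummer corner
`(p, e) ∈ {(5, 4), (7, 6)}` (cruxes stmt-BirchSwinnertonDyer-24306 / 24307 / 23883), where the tame exponent is `b = 1` and the twisted
shape `(1, 2b) = (1, 2)` is adjacent, outside the generic evaluation used at `p ≥ 11` (`TeichmullerTwistDescentWeightExclusionOfThreeFacts`).
The private bookkeeping lemmas of the predecessor file are re-proved here (they are private there).
References: J.-P. Serre, Duke Math. J. 54 (1987), §2.1 Prop. 1, §2.2, §2.3 (2.3.2), §2.4 (i), (ii₁), (ii₂) [Serre1987].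
-/

noncomputable section

open scoped MatrixGroups Valued
open Field ValuativeRel

namespace Literature.NumberTheory.GaloisRepresentations

namespace ModPGaloisRep

open GaloisRepresentations.IsNonarchimedeanLocalField InertiaShape

universe u v

variable {F : Type u} [Field F] [ValuativeRel F] [TopologicalSpace F] [IsNonarchimedeanLocalField F]
variable {k : Type v} [Field k] [TopologicalSpace k]
variable {ρ : ModPGaloisRep F k 2} {ι : absIntegers 𝒪[F] F ⧸ absMaximalIdeal F →+* k}

/-! ### Bookkeeping on triangular forms (private re-proofs of the predecessor file's helpers) -/

/-- The diagonal characters of a triangular form `P ρ̄ P⁻¹ = (χ^a c; 0 χ^b)` take the values `(χ σ ^ a, χ σ ^ b)` (private helper).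
[folklore] -/
private theorem diagChar_conjRestrict_of_shape' {χ : absInertia F →* kˣ} {a b : ℕ} {P : GL (Fin 2) k}
    (hP : ∀ σ : absInertia F, ∃ c : k,
      ((P * ρ (σ : absoluteGaloisGroup F) * P⁻¹ : GL (Fin 2) k) : Matrix (Fin 2) (Fin 2) k) =
        !![((χ σ ^ a : kˣ) : k), c; 0, ((χ σ ^ b : kˣ) : k)]) :
    ∃ hf : ∀ σ, (conjRestrict ρ P σ : Matrix (Fin 2) (Fin 2) k) 1 0 = 0,
      (∀ σ, diagChar (conjRestrict ρ P) hf 0 σ = χ σ ^ a) ∧ (∀ σ, diagChar (conjRestrict ρ P) hf 1 σ = χ σ ^ b) := by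
  have hf : ∀ σ, (conjRestrict ρ P σ : Matrix (Fin 2) (Fin 2) k) 1 0 = 0 := by
    intro σ
    obtain ⟨c, hc⟩ := hP σ
    rw [conjRestrict_apply, hc]
    rfl
  refine ⟨hf, fun σ => ?_, fun σ => ?_⟩
  · obtain ⟨c, hc⟩ := hP σ
    ext
    rw [coe_diagChar_apply, conjRestrict_apply, hc]
    simp
  · obtain ⟨c, hc⟩ := hP σ
    ext
    rw [coe_diagChar_apply, conjRestrict_apply, hc]
    simp

/-- Two triangular forms are conjugate: `conjRestrict ρ R σ = (R P⁻¹) (conjRestrict ρ P σ) (R P⁻¹)⁻¹` (private helper). [folklore] -/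
private theorem conjRestrict_conj' (P R : GL (Fin 2) k) (σ : absInertia F) :
    conjRestrict ρ R σ = (R * P⁻¹) * conjRestrict ρ P σ * (R * P⁻¹)⁻¹ := by
  rw [conjRestrict_apply, conjRestrict_apply, mul_inv_rev, inv_inv]
  group

/-- Any two level-one triangular forms have the same exponent characters up to order (values) (private helper). [folklore] -/
private theorem pow_eq_or_swap_of_two_shapes' {χ : absInertia F →* kˣ} {β α x y : ℕ} {P R : GL (Fin 2) k}
    (hP : ∀ σ : absInertia F, ∃ c : k,
      ((P * ρ (σ : absoluteGaloisGroup F) * P⁻¹ : GL (Fin 2) k) : Matrix (Fin 2) (Fin 2) k) =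
        !![((χ σ ^ β : kˣ) : k), c; 0, ((χ σ ^ α : kˣ) : k)])
    (hR : ∀ σ : absInertia F, ∃ c : k,
      ((R * ρ (σ : absoluteGaloisGroup F) * R⁻¹ : GL (Fin 2) k) : Matrix (Fin 2) (Fin 2) k) =
        !![((χ σ ^ x : kˣ) : k), c; 0, ((χ σ ^ y : kˣ) : k)]) :
    (∀ σ, χ σ ^ x = χ σ ^ β ∧ χ σ ^ y = χ σ ^ α) ∨ (∀ σ, χ σ ^ x = χ σ ^ α ∧ χ σ ^ y = χ σ ^ β) := by
  obtain ⟨hf, hd0, hd1⟩ := diagChar_conjRestrict_of_shape' hP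
  obtain ⟨hr, hr0, hr1⟩ := diagChar_conjRestrict_of_shape' hR
  rcases diagChar_eq_or_eq_swap (conjRestrict ρ P) (conjRestrict ρ R) hf hr (R * P⁻¹) (conjRestrict_conj' P R) with
    ⟨h0, h1⟩ | ⟨h0, h1⟩
  · left
    intro σ
    have e0 := congrArg (fun φ : absInertia F →* kˣ => φ σ) h0
    have e1 := congrArg (fun φ : absInertia F →* kˣ => φ σ) h1
    rw [hd0, hr0] at e0
    rw [hd1, hr1] at e1
    exact ⟨e0.symm, e1.symm⟩
  · right
    intro σ
    have e0 := congrArg (fun φ : absInertia F →* kˣ => φ σ) h0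
    have e1 := congrArg (fun φ : absInertia F →* kˣ => φ σ) h1
    rw [hd0, hr1] at e0
    rw [hd1, hr0] at e1
    exact ⟨e1.symm, e0.symm⟩

omit [TopologicalSpace k] in
/-- Exponents of `ψ₁` below `q − 1` are determined by the character (private helper). [folklore] -/
private theorem exponent_eq_of_pow_eq' (hι : Function.Injective ι) {ϖ : 𝒪[F]} (hϖ : Irreducible ϖ) {x y : ℕ}
    (hx : x + 2 ≤ residueFieldCard F) (hy : y + 2 ≤ residueFieldCard F)
    (hxy : ∀ σ, fundamentalCharacter F 1 ι ϖ hϖ σ ^ x = fundamentalCharacter F 1 ι ϖ hϖ σ ^ y) : x = y := by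
  have hord : ∀ e, fundamentalCharacter F 1 ι ϖ hϖ ^ e = 1 ↔ residueFieldCard F - 1 ∣ e := fun e =>
    fundamentalCharacter_one_pow_eq_one_iff ι hι ϖ hϖ e
  have key : ∀ {x y : ℕ}, x ≤ y → y + 2 ≤ residueFieldCard F →
      (∀ σ, fundamentalCharacter F 1 ι ϖ hϖ σ ^ x = fundamentalCharacter F 1 ι ϖ hϖ σ ^ y) → x = y := by
    intro x y hle hy hxy
    have h1 : fundamentalCharacter F 1 ι ϖ hϖ ^ (y - x) = 1 := by
      ext σ : 1
      rw [MonoidHom.pow_apply, MonoidHom.one_apply, pow_sub _ hle, ← hxy σ, mul_inv_cancel]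
    rcases Nat.eq_zero_or_pos (y - x) with h0 | hpos
    · omega
    · have := Nat.le_of_dvd hpos ((hord _).mp h1)
      omega
  rcases le_total x y with hle | hle
  · exact key hle hy hxy
  · exact (key hle hx fun σ => (hxy σ).symm).symm

omit [TopologicalSpace k] in
/-- `ψ₁ σ ^ (q − 1) = 1` pointwise (private helper). [folklore] -/
private theorem fundamentalCharacter_one_apply_pow_eq_one' (ϖ : 𝒪[F]) (hϖ : Irreducible ϖ) (σ : absInertia F) :
    fundamentalCharacter F 1 ι ϖ hϖ σ ^ (residueFieldCard F - 1) = 1 := by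
  have := congrArg (fun φ : absInertia F →* kˣ => φ σ) (fundamentalCharacter_one_pow_eq_one F ι ϖ hϖ)
  simpa only [MonoidHom.pow_apply, MonoidHom.one_apply] using this

/-! ### The lower bound -/

variable (ρ ι)

/-- **Lower bound `1 + q·min(α, β) + max(α, β) ≤ k(ρ̄_F)` for a level-one shape `(ψ₁^β ∗; 0 ψ₁^α)` with `1 ≤ α, β ≤ q − 2`** —
no condition `|α − β| ≠ 1`, no uniqueness hypothesis (`k` discrete; `ι` is automatically injective).  TAME: every tame normalisation has
exponents `{α, β}` ((2.3.2), value attained); WILD: every wild normalisation `(β', α')` has `{β', α'} = {β, α}` and §2.4 gives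
`1 + q·min + max` in cases (i)/(ii₁) and that value `+ (q − 1)` in case (ii₂) (très ramifiée; `q ≠ 2` as `q ≥ α + 2 ≥ 3`); the level-two
case does not occur (`not_isLevelTwoWeight_of_hasLevelOneInertiaShape`).
[cite: Serre1987, §2.3 (2.3.2), §2.4 (i), (ii₁), (ii₂)] -/
theorem le_serreWeightLocal_of_hasLevelOneInertiaShape [DiscreteTopology k]
    {ϖ : 𝒪[F]} (hϖ : Irreducible ϖ) {β α : ℕ} (h : ρ.HasLevelOneInertiaShape ι ϖ hϖ β α)
    (hα1 : 1 ≤ α) (hαq : α + 2 ≤ residueFieldCard F) (hβ1 : 1 ≤ β) (hβq : β + 2 ≤ residueFieldCard F) :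
    1 + residueFieldCard F * min α β + max α β ≤ ρ.serreWeightLocal ι := by
  classical
  have hι : Function.Injective ι := residueEmbedding_injective ι
  -- no level-two weight
  have h2 : ¬ ∃ m, ρ.IsLevelTwoWeight ι m := fun ⟨m, hm⟩ =>
    not_isLevelTwoWeight_of_hasLevelOneInertiaShape hι hϖ h m hm
  obtain ⟨P, hP⟩ := id h
  -- comparison with any other level-one normalisation `(x, y)` (w.r.t. any uniformiser)
  have hcmp : ∀ {ϖ' : 𝒪[F]} {hϖ' : Irreducible ϖ'} {x y : ℕ}, ρ.HasLevelOneInertiaShape ι ϖ' hϖ' x y →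
      (∀ σ, fundamentalCharacter F 1 ι ϖ hϖ σ ^ x = fundamentalCharacter F 1 ι ϖ hϖ σ ^ β ∧
          fundamentalCharacter F 1 ι ϖ hϖ σ ^ y = fundamentalCharacter F 1 ι ϖ hϖ σ ^ α) ∨
        (∀ σ, fundamentalCharacter F 1 ι ϖ hϖ σ ^ x = fundamentalCharacter F 1 ι ϖ hϖ σ ^ α ∧
          fundamentalCharacter F 1 ι ϖ hϖ σ ^ y = fundamentalCharacter F 1 ι ϖ hϖ σ ^ β) := by
    intro ϖ' hϖ' x y hR
    obtain ⟨R, hR⟩ := hR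
    have hχ' : fundamentalCharacter F 1 ι ϖ' hϖ' = fundamentalCharacter F 1 ι ϖ hϖ :=
      fundamentalCharacter_eq_holds F 1 ι ϖ' ϖ hϖ' hϖ
    have hR' : ∀ σ : absInertia F, ∃ c : k,
        ((R * ρ (σ : absoluteGaloisGroup F) * R⁻¹ : GL (Fin 2) k) : Matrix (Fin 2) (Fin 2) k) =
          !![((fundamentalCharacter F 1 ι ϖ hϖ σ ^ x : kˣ) : k), c; 0, ((fundamentalCharacter F 1 ι ϖ hϖ σ ^ y : kˣ) : k)] := by
      intro σ; obtain ⟨c, hc⟩ := hR σ; exact ⟨c, by rw [hc, hχ']⟩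
    exact pow_eq_or_swap_of_two_shapes' hP hR'
  by_cases ht : ρ.IsTamelyRamified
  · -- TAME: the shape `(min, max)` is available, and every tame normalisation is `(min, max)` (the value is attained)
    have hshape : ρ.HasLevelOneInertiaShape ι ϖ hϖ (min α β) (max α β) := by
      rcases le_total β α with hle | hle
      · rw [min_eq_right hle, max_eq_left hle]; exact h
      · rw [min_eq_left hle, max_eq_right hle]; exact h.symm_of_isTamelyRamified ht
    have hmem : ρ.IsLevelOneTameWeight ι (1 + residueFieldCard F * min α β + max α β) := by
      refine ⟨ht, min α β, max α β, min_le_max, ?_, ⟨ϖ, hϖ, hshape⟩, ?_⟩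
      · rcases le_total β α with hle | hle
        · rw [max_eq_left hle]; exact hαq
        · rw [max_eq_right hle]; exact hβq
      · rw [if_neg (by rintro ⟨h0, -⟩; have := le_min hα1 hβ1; omega)]
    have hall : ∀ m ∈ {m | ρ.IsLevelOneTameWeight ι m}, 1 + residueFieldCard F * min α β + max α β ≤ m := by
      rintro m ⟨-, a', b', hab, hbq, hs, rfl⟩
      obtain ⟨ϖ', hϖ', hs⟩ := hs
      rcases hcmp hs with hxy | hxy
      · have ha : a' = β := exponent_eq_of_pow_eq' hι hϖ (by omega) hβq fun σ => (hxy σ).1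
        have hb : b' = α := exponent_eq_of_pow_eq' hι hϖ hbq hαq fun σ => (hxy σ).2
        subst ha; subst hb
        rw [if_neg (by rintro ⟨h0, -⟩; omega), min_eq_right hab, max_eq_left hab]
      · have ha : a' = α := exponent_eq_of_pow_eq' hι hϖ (by omega) hαq fun σ => (hxy σ).1
        have hb : b' = β := exponent_eq_of_pow_eq' hι hϖ hbq hβq fun σ => (hxy σ).2
        subst ha; subst hb
        rw [if_neg (by rintro ⟨h0, -⟩; omega), min_eq_left hab, max_eq_right hab]
    unfold serreWeightLocal
    rw [if_neg h2, if_pos ht]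
    exact le_csInf ⟨_, hmem⟩ fun m hm => hall m hm
  · -- WILD: §2.4 with `(α', β') = (α, β)` is a member; every wild normalisation has the same unordered exponents, and the
    -- très ramifiée correction (ii₂) only adds `q - 1`
    have hmem : ρ.IsLevelOneWildWeight ι
        (if β = α + 1 ∧ ρ.IsTresRamifie then
            (if residueFieldCard F = 2 then 4 else (α + 1) * (residueFieldCard F + 1))
          else 1 + residueFieldCard F * min α β + max α β) :=
      ⟨ht, α, β, hαq, hβ1, by omega, ⟨ϖ, hϖ, h⟩, rfl⟩
    have hall : ∀ m ∈ {m | ρ.IsLevelOneWildWeight ι m}, 1 + residueFieldCard F * min α β + max α β ≤ m := by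
      rintro m ⟨-, a', b', haq, hb1, hbq, hs, rfl⟩
      obtain ⟨ϖ', hϖ', hs⟩ := hs
      have hord : ∀ e, fundamentalCharacter F 1 ι ϖ hϖ ^ e = 1 ↔ residueFieldCard F - 1 ∣ e := fun e =>
        fundamentalCharacter_one_pow_eq_one_iff ι hι ϖ hϖ e
      -- the first exponent `b'` of the wild normalisation is not `q - 1` (neither `ψ₁^β` nor `ψ₁^α` is trivial)
      have hbq' : b' + 2 ≤ residueFieldCard F := by
        by_contra hcon
        have hb' : b' = residueFieldCard F - 1 := by omega
        have htriv : ∀ {e : ℕ}, (∀ σ, fundamentalCharacter F 1 ι ϖ hϖ σ ^ b' = fundamentalCharacter F 1 ι ϖ hϖ σ ^ e) →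
            residueFieldCard F - 1 ∣ e := by
          intro e hσ
          refine (hord e).mp ?_
          ext σ : 1
          rw [MonoidHom.pow_apply, MonoidHom.one_apply, ← hσ σ, hb', fundamentalCharacter_one_apply_pow_eq_one' ϖ hϖ σ]
        rcases hcmp hs with hxy | hxy
        · have := Nat.le_of_dvd (by omega) (htriv fun σ => (hxy σ).1)
          omega
        · have := Nat.le_of_dvd (by omega) (htriv fun σ => (hxy σ).1)
          omega
      -- the unordered exponents `{b', a'} = {β, α}`, hence the same `min` / `max`
      have hmm : min a' b' = min α β ∧ max a' b' = max α β := by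
        rcases hcmp hs with hxy | hxy
        · have hb : b' = β := exponent_eq_of_pow_eq' hι hϖ hbq' hβq fun σ => (hxy σ).1
          have ha : a' = α := exponent_eq_of_pow_eq' hι hϖ haq hαq fun σ => (hxy σ).2
          subst ha; subst hb
          exact ⟨rfl, rfl⟩
        · have hb : b' = α := exponent_eq_of_pow_eq' hι hϖ hbq' hαq fun σ => (hxy σ).1
          have ha : a' = β := exponent_eq_of_pow_eq' hι hϖ haq hβq fun σ => (hxy σ).2
          subst ha; subst hb
          exact ⟨min_comm _ _, max_comm _ _⟩
      obtain ⟨hmin, hmax⟩ := hmm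
      split_ifs with hcase hq2
      · -- très ramifiée with `q = 2`: impossible, `q ≥ α + 2 ≥ 3`
        omega
      · -- très ramifiée, `q ≠ 2`: `(a' + 1)(q + 1) = 1 + q·a' + (a' + 1) + (q - 1)` with `(min, max) = (a', a' + 1)`
        obtain ⟨hba, -⟩ := hcase
        rw [← hmin, ← hmax, hba, min_eq_left (Nat.le_succ a'), max_eq_right (Nat.le_succ a')]
        nlinarith
      · rw [← hmin, ← hmax]
    unfold serreWeightLocal
    rw [if_neg h2, if_neg ht]
    exact le_csInf ⟨_, hmem⟩ fun m hm => hall m hm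

variable {ρ ι}

/-- **Global form of the lower bound**: for a local restriction datum `loc` at `p` of `ρ̄ : Γ_ℚ → GL₂(k)` with
`loc.rep|I ∼ (ω^β ∗; 0 ω^α)` and `1 ≤ α, β ≤ p − 2` (adjacent exponents allowed):
`1 + p·min(α, β) + max(α, β) ≤ serreWeight p ρ̄ loc ι`. [cite: Serre1987, §2.3 (2.3.2), §2.4 (i), (ii₁), (ii₂)] -/
theorem le_serreWeight_of_hasLevelOneInertiaShape [DiscreteTopology k] {p : ℕ} {ρ : ModPGaloisRep ℚ k 2}
    (loc : LocalRestrictionAt p ρ) (ι : absIntegers 𝒪[loc.F] loc.F ⧸ absMaximalIdeal loc.F →+* k) {β α : ℕ}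
    (h : loc.rep.HasLevelOneInertiaShape ι ((p : ℕ) : 𝒪[loc.F]) loc.irreducible_natCast β α)
    (hα1 : 1 ≤ α) (hαp : α + 2 ≤ p) (hβ1 : 1 ≤ β) (hβp : β + 2 ≤ p) :
    1 + p * min α β + max α β ≤ serreWeight p ρ loc ι := by
  have hq := loc.residueFieldCard_eq
  have e := le_serreWeightLocal_of_hasLevelOneInertiaShape loc.rep ι loc.irreducible_natCast h hα1
    (by rw [hq]; exact hαp) hβ1 (by rw [hq]; exact hβp)
  rw [hq] at e
  exact e

end ModPGaloisRep

end Literature.NumberTheory.GaloisRepresentations
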